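import Summits.ResolutionOfSingularities.ResolutionOfSingularities.Theorems.FrobeniusLadderFRationalResolutionFixedPointCompletionChartParameters
import Summits.ResolutionOfSingularities.ResolutionOfSingularities.Theorems.FrobeniusLadderFRationalResolutionMonomialAlgebraCompletion
import Summits.ResolutionOfSingularities.ResolutionOfSingularities.Theorems.FrobeniusLadderFRationalResolutionBlowupRegularFlatChart
import HarnessLib

/-!
# Crux `FrobeniusLadder.FRationalResolution` (stmt-ResolutionOfSingularities-15317), line `redirect`,
# stub `stub_diagonalizableQuotientResolution` — **ONE BLOW-UP RESOLVES THE QUOTIENT CHART LOCALLY AT A FIXED POINT whenever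
# the toric model's vertex blow-up is regular** (no Galois data, any residue field, every characteristic)

`…FixedPointCompletionChartParameters` (p840822): at a `D(A)`-fixed prime `𝔔` of a regular graded `S` with homogeneous regular
parameters `xᵢ ∈ S_{aᵢ}`, `κ(𝔮)⟦P⟧ ≃+* ((S₀)_𝔮)^` for the weight kernel `P`. `…MonomialAlgebraCompletion` (p840652): for the
monomial algebra `T = κ[χᵈ : d ∈ G]` (`G` finite, `0 ∉ G`, `⟨G⟩ = P`) at its vertex, `κ⟦P⟧ ≃+* (T_𝔳)^`. Composing, the two
complete local rings agree, so (`…ToricModelTransfer.isRegular_affineBlowup_maximalIdeal_of_ringEquiv_model`, p840407)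
`Bl_𝔳(Spec T)` regular ⇒ `Bl_𝔪(Spec ((S₀)_𝔮)^)` regular ⇒ (faithfully flat descent `…BlowupRegularFlatChart.isRegular_affineBlowup_of_adicCompletion`)
`Bl_𝔪(Spec (S₀)_𝔮)` regular:

* ★★★★ `isRegular_affineBlowup_maximalIdeal_of_parameters` — `S` of finite type over a field `k`, graded by a torsion group, `𝔔`
  fixed with homogeneous regular parameters `x, a`, `P` the weight kernel generated by a finite `G ∌ 0`, `Rq` any localization
  of `S₀` at `𝔮 = 𝔔 ∩ S₀`: if `Bl_𝔳 Spec κ(𝔮)[χᵈ : d ∈ G]` is a regular scheme then so is `Bl_{𝔪_{Rq}} Spec Rq`.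
  (The model isomorphism `(κ(𝔮)[χᵈ : d ∈ G]_𝔳)^ ≃+* Rq^` is built inside the proof; it is not stated separately because
  `AdicCompletion (maximalIdeal (Localization.AtPrime 𝔳)) _` for an ideal `𝔳` of a subalgebra does not elaborate in statements.)

The cone programme's certificates (`veroneseCone_isRegular_affineBlowup` p807148, `segreCone_isRegular_affineBlowup` p805118,
the vertex classes of the fan probe) therefore resolve the corresponding quotient points LOCALLY by one blow-up. Honest label:
helper theorems toward ONE leaf stub (no stub, crux or summit closed). No definitions, no named facts, no sorry.
[cite: Kato1994, Thm. (3.2)] [cite: Matsumura1987, Thm. 8.11; Thm. 8.14; §32 p. 256] [cite: StacksProject, Tag 07PT]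
-/

noncomputable section

-- single-problem summit: the doubled namespace component is forced
set_option linter.dupNamespace false

open AlgebraicGeometry IsLocalRing
open Literature.RingTheory.MvPowerSeries Literature.RingTheory.MvPowerSeries.monoidPowerSeries
open Literature.AlgebraicGeometry.Resolution
open Literature.AlgebraicGeometry.Resolution.DiagonalizableQuotient

namespace Summit.ResolutionOfSingularities.ResolutionOfSingularities.Theorems.FRationalResolution.FixedPointBlowupRegular

universe w

variable {k : Type} [Field k] {A : Type w} [DecidableEq A] [AddCommGroup A] {S : Type}
  [CommRing S] [Algebra k S] (𝒮 : A → Submodule k S) [GradedAlgebra 𝒮]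

/-- ★★★★ **ONE BLOW-UP AT A FIXED POINT, FROM THE TORIC MODEL.** `S` of finite type over a field `k`, graded by a torsion group
`A`; `𝔔` a prime containing every `S_a`, `a ≠ 0`, with homogeneous `xᵢ ∈ 𝔔 ∩ S_{aᵢ}` (`i < n`) generating `𝔪_{S_𝔔}`,
`n = dim S_𝔔`; `P = {m : Σ mᵢ • aᵢ = 0} = ⟨G⟩`, `G` finite, `0 ∉ G`; `Rq` any localization of `S₀` at `𝔮 = 𝔔 ∩ S₀`. If the
blow-up of `Spec κ(𝔮)[χᵈ : d ∈ G]` at its vertex is a regular scheme, then **`Bl_{𝔪_{Rq}}(Spec Rq)` is a regular scheme**.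
[cite: Kato1994, Thm. (3.2)] [cite: Matsumura1987, Thm. 8.11; Thm. 8.14; §32 p. 256] [cite: StacksProject, Tag 07PT] -/
theorem isRegular_affineBlowup_maximalIdeal_of_parameters [Algebra.FiniteType k S]
    (hA : AddMonoid.IsTorsion A) (𝔔 : Ideal S) [𝔔.IsPrime]
    (hfix : ∀ a : A, a ≠ 0 → ∀ s ∈ 𝒮 a, s ∈ 𝔔)
    {n : ℕ} (x : Fin n → S) (a : Fin n → A) (hxa : ∀ i, x i ∈ 𝔔 ∧ x i ∈ 𝒮 (a i))
    (hspan : Ideal.span (algebraMap S (Localization.AtPrime 𝔔) '' Set.range x) =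
      maximalIdeal (Localization.AtPrime 𝔔))
    (hn : (n : WithBot ℕ∞) = ringKrullDim (Localization.AtPrime 𝔔))
    (P : AddSubmonoid (Fin n →₀ ℕ)) (hP : ∀ m, m ∈ P ↔ Finsupp.weight a m = 0)
    (G : Set (Fin n →₀ ℕ)) (hGfin : G.Finite) (hG0 : (0 : Fin n →₀ ℕ) ∉ G) (hGP : AddSubmonoid.closure G = P)
    (Rq : Type) [CommRing Rq] [Algebra (𝒮 0) Rq]
    [IsLocalization.AtPrime Rq (𝔔.comap (algebraMap (𝒮 0) S))] [IsLocalRing Rq]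
    (hreg : Scheme.IsRegular (affineBlowup (Ideal.span {v : ↥(Algebra.adjoin (ResidueField Rq)
        ((fun d : Fin n →₀ ℕ => MvPolynomial.monomial d (1 : ResidueField Rq)) '' G)) |
        ∃ d ∈ G, (v : MvPolynomial (Fin n) (ResidueField Rq)) = MvPolynomial.monomial d 1}))) :
    Scheme.IsRegular (affineBlowup (maximalIdeal Rq)) := by
  haveI := MonomialAlgebraVertex.vertexIdeal_isMaximal (ResidueField Rq) G hG0
  haveI : IsNoetherianRing (𝒮 0) := isNoetherianRing_gradeZero 𝒮 hA
  haveI : IsNoetherianRing Rq :=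
    IsLocalization.isNoetherianRing (𝔔.comap (algebraMap (𝒮 0) S)).primeCompl Rq inferInstance
  haveI : Algebra.FiniteType (ResidueField Rq) (↥(Algebra.adjoin (ResidueField Rq)
      ((fun d : Fin n →₀ ℕ => MvPolynomial.monomial d (1 : ResidueField Rq)) '' G))) :=
    MonomialAlgebraVertex.finiteType (ResidueField Rq) G hGfin
  haveI : IsNoetherianRing (↥(Algebra.adjoin (ResidueField Rq)
      ((fun d : Fin n →₀ ℕ => MvPolynomial.monomial d (1 : ResidueField Rq)) '' G))) :=
    Algebra.FiniteType.isNoetherianRing (ResidueField Rq) _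
  -- `κ(𝔮)⟦P⟧ ≅ Rq^` (fixed-point chart) and `κ(𝔮)⟦P⟧ ≅ (T_𝔳)^` (monomial model)
  obtain ⟨χ, e₁, -, -⟩ := FixedPointCompletionChart.exists_ringEquiv_monoidPowerSeries_adicCompletion_of_parameters
    𝒮 hA 𝔔 hfix x a hxa hspan hn P hP Rq
  have hPfg : P.FG := ⟨hGfin.toFinset, by rw [Set.Finite.coe_toFinset, hGP]⟩
  obtain ⟨χ₀, -, hχ0, hχadd, hχm, hgen⟩ := MonomialAlgebraCompletion.exists_chart (ResidueField Rq) G hG0 P hGP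
  obtain ⟨e₀, -⟩ := MonomialAlgebraCompletion.exists_ringEquiv_monoidPowerSeries_adicCompletion_of_chart (ResidueField Rq) _
    (MonomialAlgebraVertex.exists_sub_algebraMap_mem_maximalIdeal (ResidueField Rq) G) P hPfg χ₀ hχ0 hχadd hχm hgen
    (MonomialAlgebraDimension.ringKrullDim_localization_vertex_eq_rank (ResidueField Rq) G hGfin hG0 P hGP)
  -- transport the regular vertex blow-up to `Rq^`, then descend to `Rq`
  have h := ToricModelTransfer.isRegular_affineBlowup_maximalIdeal_of_ringEquiv_model (ResidueField Rq) _ hreg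
    (e₀.symm.trans e₁)
  rw [AdicCompletion.maximalIdeal_eq_map] at h
  exact BlowupRegularFlatChart.isRegular_affineBlowup_of_adicCompletion (maximalIdeal Rq) h

end Summit.ResolutionOfSingularities.ResolutionOfSingularities.Theorems.FRationalResolution.FixedPointBlowupRegular

end
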